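import Summits.Ventures.HodgeRepro0.P6AokiQuotientCard
import Summits.Ventures.HodgeRepro0.P6AokiQuotientLevel84
import Summits.Ventures.HodgeRepro0.P6AokiQuotientLevel132

/-!
# The `Nat.card` corollary of the kernel certificate at the levels 84 and 132

The committed general lemma `card_quotient_eq_two_pow` (P6AokiQuotientCard.lean) applied to
parts (2)–(3) of the kernel certificates `L84.main` / `L132.main`
(P6AokiQuotientLevel84.lean / P6AokiQuotientLevel132.lean): the quotient
`B_q / (S_q + D_q)` has exactly `2 ^ 3 = 8` elements at `q = 84 = 4·3·7` and at
`q = 132 = 4·3·11`, the same one-line pattern as the eleven levels of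
P6AokiQuotientCardLevels.lean.  Record-only (R-5 / R-17): a supporting artefact,
nothing on the Hodge conjecture at any degree.
-/

namespace HodgeRepro0.P6AokiQuotient

/-- LEVEL 84 = 4·3·7: `|B_84 / (S_84 + D_84)| = 2^3`, from parts (2)–(3) of `L84.main`. -/
theorem L84.card : Nat.card (B 84 ⧸ (SD 84).comap (B 84).subtype) = 2 ^ 3 :=
  card_quotient_eq_two_pow _ L84.main.2.1 L84.main.2.2.1

/-- LEVEL 132 = 4·3·11: `|B_132 / (S_132 + D_132)| = 2^3`, from parts (2)–(3) of `L132.main`. -/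
theorem L132.card : Nat.card (B 132 ⧸ (SD 132).comap (B 132).subtype) = 2 ^ 3 :=
  card_quotient_eq_two_pow _ L132.main.2.1 L132.main.2.2.1

end HodgeRepro0.P6AokiQuotient
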